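import Mathlib
import Literature.AlgebraicGeometry.Motives.BettiRealization
import Literature.AlgebraicGeometry.Motives.MotivatedCycles
import Literature.AlgebraicGeometry.Motives.EtaleTate
import HarnessLib

/-!
# André's motivated Galois group and the Mumford–Tate group: Tannakian invariant counts on powers

André 1996 (*Pour une théorie inconditionnelle des motifs*, Publ. Math. IHÉS 83), §4.6, p. 24, for
`K ⊆ ℂ` and the Betti realisation `H_B`: the motivated Galois group `G_B(M)` of a motive `M`
(modelled on a family `𝒱` of smooth projective `K`-schemes) is the image of the pro-algebraic
group `G_{𝒱,B} = Aut^⊗(H_B | 𝓜(𝒱))` in `GL(H_B(M))`, and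
"(i) `G_B(M)` est proréductif (du fait que `𝓜(𝒱)` est semi-simple);
 (ii) `G_B(M)` est le sous-groupe algébrique de `GL(H_B(M))` qui fixe les cycles motivés parmi les
 tenseurs mixtes sur `H_B(M)`; réciproquement, tout tenseur mixte sur `H_B(M)` fixé par `G_B(M)`
 est motivé."
Remarque (ii), p. 25: "Même dans le contexte des cycles de Hodge absolus, et pour `K = ℂ`, la
connexité des groupes de Galois motiviques ne semble pas connue" — connectedness of `G_B(M)` is
NOT claimed. For `K ⊆ ℂ` and `H = H_B`, `G_B(M)` contains the Mumford–Tate group (p. 31, §6.2;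
motivated cycles are Hodge cycles). On the Hodge side (Deligne, *Hodge cycles on abelian
varieties*, LNM 900, I §3): the Mumford–Tate group `MT(V)` of a rational Hodge structure `V` is the
`ℚ`-subgroup of `GL(V) × 𝔾_m` fixing the Hodge cycles in the mixed tensor spaces
`T^{m₁,m₂,m₃} = V^{⊗m₁} ⊗ V^{∨⊗m₂} ⊗ ℚ(m₃)` (definition p. 42), it is the smallest `ℚ`-subgroup
through which `μ : 𝔾_m → GL(V_ℂ)` factors (Prop. 3.4 — hence CONNECTED), and it is REDUCTIVE when
`V` is polarizable (Prop. 3.6).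

This file vendors these results as the **"Tannakian counts" predicate** on a Betti–Hodge
realization datum `B : BettiHodgeData ℂ` (`BettiRealization.lean`) requested by route
HodgeConjecture/MomentAmplification (crux `BettiBridge`, clause (4); support `Amplification`; ledger
cite item wi-10052), phrased — exactly as that route's crux `HalfOrAll` consumes it — through
ABSTRACT subgroups `M ≤ G` of `GL_d(ℂ) = ((Fin d → ℂ) ≃ₗ[ℂ] (Fin d → ℂ))` acting on the mixed
tensor spaces `T^{a,b} = hodgeTensorSpaceOver ℂ (Fin d → ℂ) a b = (ℂ^d)^{⊗a} ⊗ ((ℂ^d)^∨)^{⊗b}`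
through `tensorSpaceActOver g = g^{⊗a} ⊗ ((g⁻¹)^∨)^{⊗b}` (both from `EtaleTate.lean`). The tree
DOES carry elementary point-group forms of the two groups — André's `G_mot` as
`WeilCohomology.motivatedAut` / `BettiHodgeData.motivatedAut B S` (`MotivatedAut.lean`, the
`K`-points in elementary form) and `HodgeStructure.mumfordTateGroup H : Subgroup (V ≃ₗ[ℚ] V)` with
its base change `mumfordTateGroupBaseChange K H` (`HodgeTensor.lean`, `EtaleTate.lean`) — but the
predicate's `M`, `G` are deliberately NOT tied to `mumfordTateGroupBaseChange ℂ (B.hodge hX i)` or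
`B.motivatedAut`: only the two dimension counts tie them to `B`, because that route-literal shape
(no linear-algebraic-group or Tannakian structure, which Mathlib lacks) is what `BettiBridge` /
`HalfOrAll` quantify over.

* `Andre1996_motivatedGaloisGroup_tannakianCounts B` — for every smooth projective complex `X` of
  dimension `n` there are `d` and subgroups `M ≤ G ≤ GL_d(ℂ)` such that (RED) `M` and `G` act
  completely reducibly on every `T^{a,b}`, (CONN) every finite-index subgroup of `M` fixes
  exactly the tensors `M` fixes, (FIX) `G` fixes a non-zero vector of `ℂ^d`, and (COUNTS) for
  every `N` (with a smooth-projectivity witness `hN` of the power `X^{2N} = ((𝟙 ⊗ X) ⊗ ⋯) ⊗ X`,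
  dimension `2Nn`):
  `dim_ℂ (T^{N,N})^M = dim_ℚ Hdg^{Nn}_B(X^{2N})` and `dim_ℂ (T^{N,N})^G = dim_ℚ A_mot^{Nn}(B.W, X^{2N})`
  (`(B.hodge hN _).hodgeClasses`, `B.W.motivatedClasses`). The BODY of the definition is,
  character for character, clause (4) of the route's `BettiBridge` (with its `let pow`,
  `let act`), so that `h hX` IS that clause for a prover holding `h : … B`.
* Readable vocabulary for the same clauses over the `EtaleTate.lean` carriers —
  `IsCompletelyReducibleOnMixedTensors` (RED), `FiniteIndexSubgroupsFixSameTensors` (CONN),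
  `FixesNonzeroVector` (FIX), `mixedTensorInvariantsFinrank` (INV), `schemePow` — and the
  unfolding `Andre1996_motivatedGaloisGroup_tannakianCounts_iff` (by `Iff.rfl`: the route's
  let-bound `act` is `coe_tensorSpaceActOver`, definitionally).

## Why the predicate holds at the classical Betti–Hodge realization (and what it does NOT say)

Take `H := H^*_B(X, ℚ) = ⊕_{i=0}^{2n} Hⁱ(X(ℂ), ℚ)` (TOTAL cohomology), `d := dim_ℚ H`, any basis
`H ⊗ ℂ ≅ ℂ^d`, `M := MT(H)(ℂ)` (Mumford–Tate group of the graded-polarizable Hodge structure `H`,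
acting diagonally on the graded pieces) and `G := G_B(h(X))(ℂ)` (André's motivated Galois group of
the total motive `h(X)`, §4.6). Then:
* `M ≤ G`: motivated cycles are Hodge cycles, so `MT ⊆ G_B` (André p. 31).
* RED: `MT(H)` is reductive (each `Hⁱ` is polarizable, `B.polarizable`; Deligne I Prop. 3.6) and
  `G_B(h(X))` is reductive (André §4.6 (i)); in characteristic `0` reductive = linearly reductive,
  and the abstract groups of `ℂ`-points are Zariski-dense, so `ℂ`-points-stable subspaces of
  `T^{a,b} ⊗ ℂ` are subrepresentations and have stable complements.
* CONN: `MT(H)` is connected (Deligne I Prop. 3.4: the smallest `ℚ`-subgroup containing `μ(𝔾_m)`),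
  and a finite-index subgroup of the `ℂ`-points of a connected group is Zariski-dense, hence has
  the same fixed tensors. (NOT asserted for `G`: André, Remarque (ii) p. 25.)
* FIX: `G_B` acts trivially on `H⁰(X) = ℚ · 1` (`X` is geometrically irreducible, part of
  `IsSmoothProjective`; `h⁰(X) = 𝟙`), so the unit is a non-zero fixed vector.
* COUNTS: the fixed tensors of `MT` (resp. `G_B`) in `T^{N,N}(H) = End(H^{⊗N})` are the Hodge
  classes of type `(0,0)` (Deligne I §3, definition of `MT` and Prop. 3.4) resp. the motivated
  cycles (André §4.6 (ii)), over `ℂ` after base change (invariants of algebraic groups commute with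
  field extension); `H^{⊗N} = H^*(X^N)` (Künneth), `End_{HS}(H^*(X^N)) = ⊕_b End_{HS}(H^b(X^N))`
  (morphisms of Hodge structures preserve weights) and, by Poincaré duality
  `H^a(X^N) ≅ H^{2Nn-a}(X^N)^∨(-Nn)` and Künneth for `X^{2N} = X^N × X^N`,
  `Hdg^{Nn}(X^{2N}) = ⊕_{a+b=2Nn} Hdg(H^a(X^N) ⊗ H^b(X^N)) ≅ ⊕_b End_{HS}(H^b(X^N))`; likewise
  `(T^{N,N})^{G_B} = End_{𝓜}(h(X)^{⊗N}) = End_{𝓜}(h(X^N)) = A_mot^{Nn}(X^N × X^N)` (morphisms of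
  André's category are the motivated correspondences of degree `0`, §4.2). Hence both
  dimension identities.
Formal content = a PREDICATE on an abstract `B` (hypothesis schema, explicit binder, exactly as
`Literature/Barriers/HodgeConjecture/MotivatedClassesAbelianVarieties.lean` treats André's
Thm. 0.6.2): the theorem in print is this predicate AT the classical realization, a datum the tree
does not construct; it is not a consequence of the fields of an abstract `B` (whose `hodge` and
`motivatedClasses` need not be related to any groups), so no `_holds` is owed and none is
claimed; routes take `(h : Andre1996_motivatedGaloisGroup_tannakianCounts B)` as a hypothesis.
SCOPE of what is rendered: only the two `T^{N,N}` DIMENSION identities. NOT rendered: André's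
full (ii) ("the `G_B`-fixed tensors in EVERY `T^{a,b}`, `a ≠ b` included, are exactly the motivated
classes", the content named by wi-10052 — it would need the identification of `ℂ^d` with
`H^*_B(X) ⊗ ℂ` and of `T^{a,b}` with cohomology of powers, which the abstract-subgroup shape does not
carry), connectedness of `G`, the equality `M = G` (for the classical `B`: "Hodge classes on all
powers of `X` are motivated"), and any link of `M`, `G` with `mumfordTateGroupBaseChange` /
`motivatedAut`.

## References

* Y. André, *Pour une théorie inconditionnelle des motifs*, Publ. Math. IHÉS 83 (1996) 5–49:
  §4.6 (i)(ii) p. 24, Remarque (ii) p. 25, §6.2 p. 31, §4.2 (morphisms = motivated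
  correspondences). [Andre1996Motifs]
* P. Deligne, *Hodge cycles on abelian varieties* (notes by J. S. Milne), in LNM 900 (1982), I §3:
  definition of the Mumford–Tate group (p. 42), Prop. 3.1, Prop. 3.4, Prop. 3.6.
  [Deligne1982HodgeCycles]
-/

noncomputable section

open CategoryTheory MonoidalCategory

namespace Literature.AlgebraicGeometry.Motives

/-! ### Abstract subgroups of `GL_d(ℂ)` acting on mixed tensor spaces -/

/-- (RED) An abstract subgroup `K ≤ GL_d(ℂ)` **acts completely reducibly on every mixed tensor
space** `T^{a,b} = hodgeTensorSpaceOver ℂ (Fin d → ℂ) a b = (ℂ^d)^{⊗a} ⊗ ((ℂ^d)^∨)^{⊗b}`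
(`EtaleTate.lean`; action `tensorSpaceActOver g = g^{⊗a} ⊗ ((g⁻¹)^∨)^{⊗b}`, which as a linear
map is `TensorProduct.map …` by `coe_tensorSpaceActOver`, `rfl`): every `K`-stable
`ℂ`-subspace of `T^{a,b}` has a `K`-stable complement. For the
`ℂ`-points of a reductive `ℚ`-group (Zariski-dense) this is linear reductivity in characteristic
`0`. [cite: Deligne1982HodgeCycles, I Prop. 3.1 and 3.6] -/
def IsCompletelyReducibleOnMixedTensors {d : ℕ} (K : Subgroup ((Fin d → ℂ) ≃ₗ[ℂ] (Fin d → ℂ))) :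
    Prop :=
  ∀ (a b : ℕ) (W : Submodule ℂ (hodgeTensorSpaceOver ℂ (Fin d → ℂ) a b)),
    (∀ g ∈ K, W ≤ W.comap (tensorSpaceActOver (a := a) (b := b) g :
        hodgeTensorSpaceOver ℂ (Fin d → ℂ) a b →ₗ[ℂ] hodgeTensorSpaceOver ℂ (Fin d → ℂ) a b)) →
      ∃ W' : Submodule ℂ (hodgeTensorSpaceOver ℂ (Fin d → ℂ) a b),
        (∀ g ∈ K, W' ≤ W'.comap (tensorSpaceActOver (a := a) (b := b) g :
          hodgeTensorSpaceOver ℂ (Fin d → ℂ) a b →ₗ[ℂ] hodgeTensorSpaceOver ℂ (Fin d → ℂ) a b)) ∧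
        IsCompl W W'

/-- (CONN) **Every finite-index subgroup `M' ≤ M` fixes exactly the mixed tensors `M` fixes**
(`relIndex ≠ 0` = finite index, Mathlib's convention): the abstract shadow of connectedness of the
Zariski closure (a finite-index subgroup of the `ℂ`-points of a connected algebraic group is
Zariski-dense). [cite: Deligne1982HodgeCycles, I Prop. 3.4] -/
def FiniteIndexSubgroupsFixSameTensors {d : ℕ} (M : Subgroup ((Fin d → ℂ) ≃ₗ[ℂ] (Fin d → ℂ))) :
    Prop :=
  ∀ M' : Subgroup ((Fin d → ℂ) ≃ₗ[ℂ] (Fin d → ℂ)), M' ≤ M → M'.relIndex M ≠ 0 →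
    ∀ (a b : ℕ) (t : hodgeTensorSpaceOver ℂ (Fin d → ℂ) a b),
      (∀ g ∈ M', tensorSpaceActOver (a := a) (b := b) g t = t) →
        ∀ g ∈ M, tensorSpaceActOver (a := a) (b := b) g t = t

/-- (FIX) **`G` fixes a non-zero vector** of `ℂ^d` (for the motivated Galois group: the unit of
`H⁰(X)`, on which it acts through the unit motive). [cite: Andre1996Motifs, §4.6 (p. 24)] -/
def FixesNonzeroVector {d : ℕ} (G : Subgroup ((Fin d → ℂ) ≃ₗ[ℂ] (Fin d → ℂ))) : Prop :=
  ∃ u₀ : Fin d → ℂ, u₀ ≠ 0 ∧ ∀ g ∈ G, g u₀ = u₀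

/-- (INV) `INV_K(N) = dim_ℂ (T^{N,N})^K`, the dimension of the `K`-fixed subspace of
`T^{N,N} = End((ℂ^d)^{⊗N})`. [cite: Deligne1982HodgeCycles, I §3 (p. 42)] -/
def mixedTensorInvariantsFinrank {d : ℕ} (K : Subgroup ((Fin d → ℂ) ≃ₗ[ℂ] (Fin d → ℂ))) (N : ℕ) :
    ℕ :=
  Module.finrank ℂ ↥(⨅ g ∈ K, LinearMap.eqLocus (tensorSpaceActOver (a := N) (b := N) g :
    hodgeTensorSpaceOver ℂ (Fin d → ℂ) N N →ₗ[ℂ] hodgeTensorSpaceOver ℂ (Fin d → ℂ) N N) LinearMap.id)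

/-- The powers `X^k := (⋯((𝟙 ⊗ X) ⊗ X)⋯) ⊗ X` (`k` factors) in the cartesian monoidal category of
`ℂ`-schemes, literally the `pow` let-bound in route HodgeConjecture/MomentAmplification (so
`X^{2N}` has dimension `2Nn` for `X` of dimension `n`). [folklore] -/
def schemePow (X : SchemeOver ℂ) (k : ℕ) : SchemeOver ℂ :=
  @Nat.rec (fun _ => SchemeOver ℂ) (MonoidalCategoryStruct.tensorUnit (SchemeOver ℂ))
    (fun _ Y => MonoidalCategoryStruct.tensorObj Y X) k

/-- `X^0 = 𝟙`. [folklore] -/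
@[simp] theorem schemePow_zero (X : SchemeOver ℂ) : schemePow X 0 = 𝟙_ (SchemeOver ℂ) := rfl

/-- `X^{k+1} = X^k ⊗ X`. [folklore] -/
@[simp] theorem schemePow_succ (X : SchemeOver ℂ) (k : ℕ) :
    schemePow X (k + 1) = schemePow X k ⊗ X := rfl

/-! ### The predicate -/

/-- **André's motivated Galois group over the Mumford–Tate group: Tannakian invariant counts on
powers** — André 1996, §4.6 (p. 24): (i) the motivated Galois group `G_B(M)` is (pro)reductive,
(ii) it is the subgroup of `GL(H_B(M))` fixing exactly the motivated mixed tensors; p. 31: it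
contains the Mumford–Tate group; Remarque (ii) p. 25: its connectedness is not known. Together with
Deligne, LNM 900 I §3 (the Mumford–Tate group fixes exactly the Hodge tensors, is connected
(Prop. 3.4) and reductive for polarizable Hodge structures (Prop. 3.6)), Künneth and Poincaré
duality, this gives, AT THE CLASSICAL BETTI–HODGE REALIZATION and for every smooth projective
complex `X` of dimension `n` — with `H = H^*_B(X, ℚ)` total cohomology, `d = dim H`,
`M = MT(H)(ℂ) ≤ G = G_B(h(X))(ℂ) ≤ GL(H ⊗ ℂ) ≅ GL_d(ℂ)` — abstract subgroups `M ≤ G` of `GL_d(ℂ)`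
with: (RED) `M`, `G` completely reducible on all mixed tensor spaces `T^{a,b}`; (CONN) finite-index
subgroups of `M` fix what `M` fixes; (FIX) `G` fixes a non-zero vector (the unit of `H⁰`); and for
all `N`, `dim_ℂ (T^{N,N})^M = dim_ℚ Hdg^{Nn}(X^{2N})` (`= dim End_{HS}(H^*(X^N))`) and
`dim_ℂ (T^{N,N})^G = dim_ℚ A_mot^{Nn}(X^{2N})` (`= dim End_{mot}(h(X^N))`). See the module
docstring for the derivation. VENDORED AS A PREDICATE on an abstract Betti–Hodge datum `B`
(hypothesis schema; the tree does not construct the classical `B`, and for an arbitrary `B` the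
statement is not owed — no `_holds`), whose body is VERBATIM clause (4) ("Tannakian counts") of
crux `BettiBridge` of route HodgeConjecture/MomentAmplification: `∀ X` smooth projective of
dimension `n`, `∃ d, ∃ M G ≤ GL_d(ℂ)`, `M ≤ G ∧ RED ∧ CONN(M) ∧ FIX(G) ∧ ∀ N (hN : X^{2N} smooth
projective of dim 2Nn), INV_M(N) = finrank ℚ (Hodge classes of B in H^{2Nn}(X^{2N})) ∧ INV_G(N) =
finrank ℚ (B.W.motivatedClasses of X^{2N} in codim Nn)`; readable form:
`Andre1996_motivatedGaloisGroup_tannakianCounts_iff`.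
[cite: Andre1996Motifs, §4.6 (i)(ii) (p. 24), Remarque (ii) (p. 25), p. 31]
[cite: Deligne1982HodgeCycles, I §3, Prop. 3.4 and Prop. 3.6] -/
def Andre1996_motivatedGaloisGroup_tannakianCounts (B : BettiHodgeData ℂ) : Prop :=
  (∀ ⦃n : ℕ⦄ ⦃X : Literature.AlgebraicGeometry.Motives.SchemeOver ℂ⦄, Literature.AlgebraicGeometry.Motives.IsSmoothProjective n X → (let pow := (fun k : ℕ => @Nat.rec (fun _ => Literature.AlgebraicGeometry.Motives.SchemeOver ℂ) (CategoryTheory.MonoidalCategoryStruct.tensorUnit (Literature.AlgebraicGeometry.Motives.SchemeOver ℂ)) (fun _ Y => CategoryTheory.MonoidalCategoryStruct.tensorObj Y X) k); (∃ (d : ℕ) (M G : Subgroup ((Fin d → ℂ) ≃ₗ[ℂ] (Fin d → ℂ))), (let act := (fun (a b : ℕ) (g : (Fin d → ℂ) ≃ₗ[ℂ] (Fin d → ℂ)) => TensorProduct.map (PiTensorProduct.map fun _ : Fin a => (g : (Fin d → ℂ) →ₗ[ℂ] (Fin d → ℂ))) (PiTensorProduct.map fun _ : Fin b => (g.symm.dualMap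 : Module.Dual ℂ (Fin d → ℂ) →ₗ[ℂ] Module.Dual ℂ (Fin d → ℂ)))); M ≤ G ∧ (∀ K : Subgroup ((Fin d → ℂ) ≃ₗ[ℂ] (Fin d → ℂ)), K = M ∨ K = G → ∀ (a b : ℕ) (W : Submodule ℂ (TensorProduct ℂ (TensorPower ℂ a (Fin d → ℂ)) (TensorPower ℂ b (Module.Dual ℂ (Fin d → ℂ))))), (∀ g ∈ K, W ≤ W.comap (act a b g)) → ∃ W' : Submodule ℂ (TensorProduct ℂ (TensorPower ℂ a (Fin d → ℂ)) (TensorPower ℂ b (Module.Dual ℂ (Fin d → ℂ)))), (∀ g ∈ K, W' ≤ W'.comap (act a b g)) ∧ IsCompl W W') ∧ (∀ M' : Subgroup ((Fin d → ℂ) ≃ₗ[ℂ] (Fin d → ℂ)), M' ≤ M → M'.relIndex M ≠ 0 → ∀ (a b : ℕ) (t : (TensorProduct ℂ (TensorPower ℂ a (Fin d → ℂ)) (TensorPower ℂ b (Module.Dual ℂ (Fin d → ℂ))))), (∀ g ∈ M', act a b g t = t) → ∀ g ∈ M, act a b g t = t) ∧ (∃ u₀ : (Fin d → ℂ), u₀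 ≠ 0 ∧ ∀ g ∈ G, g u₀ = u₀) ∧ ∀ (N : ℕ) (hN : Literature.AlgebraicGeometry.Motives.IsSmoothProjective (2 * N * n) (pow (2 * N))), (Module.finrank ℂ ↥(⨅ g ∈ M, LinearMap.eqLocus (act N N g) LinearMap.id)) = (Module.finrank ℚ ↥((B.hodge hN (2 * (N * n))).hodgeClasses ((N * n : ℕ) : ℤ))) ∧ (Module.finrank ℂ ↥(⨅ g ∈ G, LinearMap.eqLocus (act N N g) LinearMap.id)) = (Module.finrank ℚ ↥(B.W.motivatedClasses (2 * N * n) (pow (2 * N)) (N * n)))))))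

/-- **Readable form of the predicate** (unfolding the route's `let pow` / `let act` into the named
vocabulary of this file; definitional, `Iff.rfl`): for every smooth projective `X` of dimension
`n` there are `d` and `M ≤ G ≤ GL_d(ℂ)` with RED for `M` and `G`, CONN for `M`, FIX for `G`, and
the two invariant counts on all powers. [cite: Andre1996Motifs, §4.6 (i)(ii) (p. 24)] -/
theorem Andre1996_motivatedGaloisGroup_tannakianCounts_iff (B : BettiHodgeData ℂ) :
    Andre1996_motivatedGaloisGroup_tannakianCounts B ↔
      ∀ ⦃n : ℕ⦄ ⦃X : SchemeOver ℂ⦄, IsSmoothProjective n X →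
        ∃ (d : ℕ) (M G : Subgroup ((Fin d → ℂ) ≃ₗ[ℂ] (Fin d → ℂ))),
          M ≤ G ∧
          (∀ K : Subgroup ((Fin d → ℂ) ≃ₗ[ℂ] (Fin d → ℂ)), K = M ∨ K = G →
            IsCompletelyReducibleOnMixedTensors K) ∧
          FiniteIndexSubgroupsFixSameTensors M ∧
          FixesNonzeroVector G ∧
          ∀ (N : ℕ) (hN : IsSmoothProjective (2 * N * n) (schemePow X (2 * N))),
            mixedTensorInvariantsFinrank M N =
                Module.finrank ℚ ↥((B.hodge hN (2 * (N * n))).hodgeClasses ((N * n : ℕ) : ℤ)) ∧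
              mixedTensorInvariantsFinrank G N =
                Module.finrank ℚ ↥(B.W.motivatedClasses (2 * N * n) (schemePow X (2 * N)) (N * n)) :=
  Iff.rfl

/-- Specialisation: under the predicate, the two counting sequences of route
HodgeConjecture/MomentAmplification exist for every smooth projective `X` — the RED/CONN/FIX data
with `INV_M = h_N` (Hodge count) and `INV_G = m_N` (motivated count). [cite: Andre1996Motifs, §4.6 (i)(ii) (p. 24)] -/
theorem Andre1996_motivatedGaloisGroup_tannakianCounts.exists_counts {B : BettiHodgeData ℂ}
    (h : Andre1996_motivatedGaloisGroup_tannakianCounts B) {n : ℕ} {X : SchemeOver ℂ}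
    (hX : IsSmoothProjective n X) :
    ∃ (d : ℕ) (M G : Subgroup ((Fin d → ℂ) ≃ₗ[ℂ] (Fin d → ℂ))),
      M ≤ G ∧ IsCompletelyReducibleOnMixedTensors M ∧ IsCompletelyReducibleOnMixedTensors G ∧
        FiniteIndexSubgroupsFixSameTensors M ∧ FixesNonzeroVector G ∧
        ∀ (N : ℕ) (hN : IsSmoothProjective (2 * N * n) (schemePow X (2 * N))),
          mixedTensorInvariantsFinrank M N =
              Module.finrank ℚ ↥((B.hodge hN (2 * (N * n))).hodgeClasses ((N * n : ℕ) : ℤ)) ∧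
            mixedTensorInvariantsFinrank G N =
              Module.finrank ℚ ↥(B.W.motivatedClasses (2 * N * n) (schemePow X (2 * N)) (N * n)) := by
  obtain ⟨d, M, G, hMG, hRED, hCONN, hFIX, hINV⟩ :=
    (Andre1996_motivatedGaloisGroup_tannakianCounts_iff B).1 h hX
  exact ⟨d, M, G, hMG, hRED M (Or.inl rfl), hRED G (Or.inr rfl), hCONN, hFIX, hINV⟩

end Literature.AlgebraicGeometry.Motives
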